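import Literature.AlgebraicGeometry.Resolution.RankOneReductionProofs
import HarnessLib

/-!
# Novacoski–Spivakovsky's lifting step Cor. 2.17, TRACKED: the new model lies in `R_p`

Topic: `Literature/AlgebraicGeometry/Resolution` (proofs only; no definitions, no named facts).
The two lifting steps of Novacoski–Spivakovsky's reduction of local uniformization to rank one
(arXiv:1204.4751v1, Cor. 2.17 with Lemma 2.15, and the final step of §3.1 with Lemmas 2.18,
2.19) as proved in `RankOneReductionProofs.lean` (`novacoskiSpivakovsky2014_cor217`,
`novacoskiSpivakovsky2014_step`), with ONE MORE CONCLUSION recorded: the finitely generated model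
`A' ⊇ A` produced by each step lies inside the local ring `A_p ⊆ K` of `A` at the centre `p` of
the coarse valuation `ν₁` — stated elementarily: every `x ∈ A'` is `a s⁻¹` with `a, s ∈ A` and
`ν₁(s) = 0` — (Lemma 2.15 (1) / Lemma 2.19: the lifted blowing ups are isomorphisms
at `p` — every new generator is a fraction whose denominator lies outside `p`). The proofs are
those of `RankOneReductionProofs.lean` verbatim; the inclusion is the auxiliary statement `h1`
they already establish on the way to `A'_{p'} = A_p`.

Use (Cossart–Piltant 2019, proof of Prop. 4.8): for the extension `v̂` of a rank-one valuation
`v` of `K = Frac A` to a formal branch `K̂₁ = Frac(Â/P̂₁)`, composite of its `K`-bounded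
coarsening `ν₁` (centre `p = P∞`, the prime of `K`-infinitesimal elements) and a residual
valuation, the tracked steps produce a regular model of `Â/P̂₁` at `v̂` whose generators have
denominators outside `P∞`, i.e. `K`-finite denominators — the model `𝒪_{Ŷ,ŷ}`, "`Ŷ → Spec Â` an
isomorphism above `Spec Â_g`", consumed by `exists_adjoin_isRegularLocalRing_of_model`.

* `novacoskiSpivakovsky2014_cor217_tracked` — Cor. 2.17 with `A' ⊆ A_p` (this file);
* `novacoskiSpivakovsky2014_step_tracked` — §3.1 final step with `A' ⊆ A_p`
  (`RankOneReductionTrackedStep.lean`).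

## Source

* J. Novacoski, M. Spivakovsky, *Reduction of local uniformization to the rank one case*,
  EMS Ser. Congr. Rep. (2014); arXiv:1204.4751v1: Lemma 2.15, Cor. 2.17, Lemmas 2.18, 2.19,
  §3.1. [NovacoskiSpivakovsky2014]
-/

noncomputable section

open IsLocalRing

namespace Literature.AlgebraicGeometry.Resolution

universe u v

section tracked

variable {k : Type u} {K : Type v} [CommRing k] [Field K] [Algebra k K]

/-- Membership in the centre: `a ∈ m_O ∩ A ↔ ν(a) < 1`. [folklore] -/
private theorem mem_centre_iff_lt_one (O : ValuationSubring K) (A : Subalgebra k K)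
    (h : A.toSubring ≤ O.toSubring) (a : A.toSubring) :
    a ∈ ((maximalIdeal O).comap (Subring.inclusion h)) ↔ O.valuation a < 1 := by
  rw [Ideal.mem_comap, ValuationSubring.valuation_lt_one_iff]
  rfl

set_option maxHeartbeats 800000 in
/-- **Novacoski–Spivakovsky 2014, Cor. 2.17** (with Lemma 2.15, Def. 2.16: lifting blowing ups
of `R/p` along `ν₂` to blowing ups of `R` along `ν`). Printed statement: "Take a sequence of
local blowing ups `(R/p, m/p) → R̄⁽¹⁾ → ⋯ → R̄⁽ʳ⁾` with respect to `ν₂`. Then there exists a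
sequence of local blowing ups `(R, m) → R⁽¹⁾ → ⋯ → R⁽ⁿ⁾` with respect to `ν` such that
`R⁽ⁿ⁾_{p⁽ⁿ⁾} = R_p` and `R⁽ⁿ⁾/p⁽ⁿ⁾ ≅ R̄⁽ʳ⁾`, where `p⁽ⁿ⁾ = R⁽ⁿ⁾ ∩ m_{ν₁}`. In particular, if `R_p`
and `R̄⁽ʳ⁾` are regular, then so are `R⁽ⁿ⁾_{p⁽ⁿ⁾}` and `R⁽ⁿ⁾/p⁽ⁿ⁾`." PROVED here (weaker form) for
`ν = ν₁ ∘ ν₂` on `K/k` (`O ≤ O₁`) and an affine model `A ⊆ O` (`R = A` localised at the centre of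
`ν`, `p` = centre of `ν₁`) with `R_p` regular: IF `ν₂` — as a valuation of the residue field
`κ(O₁)`, ring `residueValuationSubring O O₁ _` — admits relative local uniformization after
restriction to every field `κ → κ(O₁)` (the paper needs only `κ = κ(p) = Frac (R/p)`, Lemma 2.3),
THEN some finitely generated `A' ⊇ A` inside `O` has `A'` localised at the centre of `ν₁`
regular and (`A'` localised at the centre of `ν`) modulo (the centre of `ν₁`) regular. Over a
base ring `k`, hypothesis `h₂` asks for the `ν₂`-uniformizing model only above the residue ring
`φ(A)` of the given model (`φ` the residue map into a subfield `κ` of `κ(O₁)`, `ι : κ → κ(O₁)`).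
Proof (Lemma 2.15): generators `b = ā/s̄` of a `ν₂`-uniformizing model of `κ ⊆ κ(O₁)` over `Φ(A)` are
lifted to `a/s ∈ O` with `s ∉ p`; the new model `A' = A[a/s, …]` has the same local ring at the
centre of `ν₁` (Lemma 2.5 (1)), and `A'_{m_ν ∩ A'} / (m_{ν₁} ∩ A')` is the local ring of the
`ν₂`-model at its centre, realised inside `κ(O₁)`. TRACKED form (this file): the conclusion also records `A' ⊆ A_p` inside `K` — the lifted generators
are fractions `a/s` with `s ∉ p` (Lemma 2.15 (1): the blowing ups are isomorphisms at `p`).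
[cite: NovacoskiSpivakovsky2014, Cor. 2.17 with Lemma 2.15] -/
theorem novacoskiSpivakovsky2014_cor217_tracked (O O₁ : ValuationSubring K) (hO : O ≤ O₁)
    (A : Subalgebra k K) (hA : A.toSubring ≤ O.toSubring) (hAfg : A.FG)
    (hfrac : IsFractionRing A K)
    (hregP : IsRegularLocalRing
      (Localization.AtPrime ((maximalIdeal O₁).comap (Subring.inclusion (hA.trans hO)))))
    (h₂ : ∀ (κ : Type v) [Field κ] [Algebra k κ] (ι : κ →+* ResidueField O₁) (φ : A →ₐ[k] κ),
      (∀ a : A, ι (φ a) = residue O₁ ⟨(a : K), (hA.trans hO) a.2⟩) →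
      IsFractionRing φ.range κ →
      ∃ (B : Subalgebra k κ)
        (hB : B.toSubring ≤ ((residueValuationSubring O O₁ hO).comap ι).toSubring),
        φ.range ≤ B ∧ B.FG ∧
        IsRegularLocalRing (Localization.AtPrime
          ((maximalIdeal ((residueValuationSubring O O₁ hO).comap ι)).comap
            (Subring.inclusion hB)))) :
    ∃ (A' : Subalgebra k K) (hA' : A'.toSubring ≤ O.toSubring), A ≤ A' ∧ A'.FG ∧
      IsRegularLocalRing
        (Localization.AtPrime ((maximalIdeal O₁).comap (Subring.inclusion (hA'.trans hO)))) ∧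
      IsRegularLocalRing
        (Localization.AtPrime ((maximalIdeal O).comap (Subring.inclusion hA')) ⧸
          ((maximalIdeal O₁).comap (Subring.inclusion (hA'.trans hO))).map
            (algebraMap A'.toSubring
              (Localization.AtPrime ((maximalIdeal O).comap (Subring.inclusion hA'))))) ∧
      (∀ x ∈ A', ∃ a ∈ A, ∃ s ∈ A, O₁.valuation s = 1 ∧ x = a * s⁻¹) := by
  classical
  haveI := hfrac
  have hAO₁ : A.toSubring ≤ O₁.toSubring := hA.trans hO
  set O₂ := residueValuationSubring O O₁ hO with hO₂def
  set P := ((maximalIdeal O₁).comap (Subring.inclusion hAO₁)) with hPdef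
  let φ : A.toSubring →+* ResidueField O₁ := ((residue O₁).comp (Subring.inclusion hAO₁))
  -- the residue field `κ = Frac (A / P)` inside `κ(O₁)`, with its `k`-structure
  let κ : Subfield (ResidueField O₁) := Subfield.closure (Set.range φ)
  have hφκ : ∀ a, φ a ∈ κ := fun a => Subfield.subset_closure ⟨a, rfl⟩
  let φκ : A →+* κ := (φ.codRestrict κ.toSubring hφκ : A.toSubring →+* κ)
  letI : Algebra k κ := (φκ.comp (algebraMap k A)).toAlgebra
  let φₐ : A →ₐ[k] κ := { φκ with commutes' := fun c => rfl }
  let ι : κ →+* ResidueField O₁ := κ.subtype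
  set O₂' := O₂.comap ι with hO₂'def
  -- basic facts about `φ`
  have hφO₂ : ∀ a : A, φ a ∈ O₂ := fun a =>
    (residue_mem_residueValuationSubring_iff O O₁ hO _).mpr (hA a.2)
  have hφunit : ∀ s : A, s ∉ P → O₁.valuation (s : K) = 1 := fun s hs =>
    (mem_primeCompl_centre_iff O₁ A hAO₁ s).mp hs
  -- the model `B₀ = φ(A)` of `κ` and its properties
  let B₀ : Subalgebra k κ := φₐ.range
  have hmemB₀ : ∀ x : κ, x ∈ B₀ ↔ ∃ a : A, φκ a = x := fun x => AlgHom.mem_range φₐ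
  have hB₀O₂' : B₀.toSubring ≤ O₂'.toSubring := by
    intro x hx
    obtain ⟨a, rfl⟩ := (hmemB₀ x).mp hx
    change ι (φκ a) ∈ O₂
    exact hφO₂ a
  have hrange : (Subring.closure (Set.range φ)) = φ.range := by
    rw [← RingHom.coe_range, Subring.closure_eq]
  haveI hB₀frac : IsFractionRing B₀ κ := by
    apply IsFractionRing.of_field
    rintro ⟨z, hz⟩
    rw [Subfield.mem_closure_iff] at hz
    obtain ⟨y, hy, w, hw, rfl⟩ := hz
    rw [hrange] at hy hw
    obtain ⟨a, rfl⟩ := hy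
    obtain ⟨b, rfl⟩ := hw
    refine ⟨⟨φκ a, (hmemB₀ _).mpr ⟨a, rfl⟩⟩, ⟨φκ b, (hmemB₀ _).mpr ⟨b, rfl⟩⟩, ?_⟩
    apply Subtype.ext
    rfl
  -- local uniformization of `ν₂` on the model `B₀`
  obtain ⟨B, hB, hB₀B, hBfg, hregB⟩ := h₂ κ ι φₐ (fun _ => rfl) hB₀frac
  obtain ⟨tB, htB⟩ := hBfg
  -- lifting elements of `κ` to fractions `a / s`, `s ∉ P`
  have hlift : ∀ b : κ, ∃ a s : A, s ∉ P ∧ (b : ResidueField O₁) = φ a / φ s := by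
    rintro ⟨z, hz⟩
    rw [Subfield.mem_closure_iff] at hz
    obtain ⟨y, hy, w, hw, rfl⟩ := hz
    rw [hrange] at hy hw
    obtain ⟨a, rfl⟩ := hy
    obtain ⟨s, rfl⟩ := hw
    by_cases hs : s ∈ P
    · refine ⟨0, 1, ?_, ?_⟩
      · exact ((maximalIdeal O₁).comap (Subring.inclusion hAO₁)).primeCompl.one_mem
      · have : φ s = 0 := (residue_inclusion_eq_zero_iff O₁ A hAO₁ s).mpr hs
        simp [this]
    · exact ⟨a, s, hs, rfl⟩
  choose fa fs hfs hlift using hlift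
  let g : κ → K := fun b => (fa b : K) / (fs b : K)
  have hgO₁ : ∀ b, g b ∈ O₁ := fun b => by
    simp only [g, div_eq_mul_inv]
    exact mul_mem (hAO₁ (fa b).2) (inv_mem_of_valuation_eq_one O₁ (hφunit _ (hfs b)))
  have hgres : ∀ b, residue O₁ ⟨g b, hgO₁ b⟩ = (b : ResidueField O₁) := fun b => by
    rw [hlift b]
    exact residue_div O₁ _ _ (hAO₁ (fa b).2) (hAO₁ (fs b).2) (hφunit _ (hfs b)) _
  have hgO : ∀ b : κ, b ∈ B → g b ∈ O := fun b hb => by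
    rw [← residue_mem_residueValuationSubring_iff O O₁ hO ⟨g b, hgO₁ b⟩, hgres b]
    exact hB hb
  -- the new model
  let A' : Subalgebra k K := A ⊔ Algebra.adjoin k (tB.image g : Set K)
  have hk : ∀ c : k, algebraMap k K c ∈ O := fun c => hA (A.algebraMap_mem c)
  have htBB : ∀ b ∈ tB, b ∈ B := fun b hb => by rw [← htB]; exact Algebra.subset_adjoin hb
  have hA'O : A'.toSubring ≤ O.toSubring := by
    have : A' ≤ ({ O.toSubring with algebraMap_mem' := hk } : Subalgebra k K) := by
      refine sup_le (fun x hx => hA hx) (Algebra.adjoin_le ?_)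
      intro x hx
      rw [Finset.coe_image] at hx
      obtain ⟨b, hb, rfl⟩ := hx
      exact hgO b (htBB b hb)
    exact fun x hx => this hx
  have hAA' : A ≤ A' := le_sup_left
  have hA'fg : A'.FG := hAfg.sup ⟨_, rfl⟩
  have hA'O₁ : A'.toSubring ≤ O₁.toSubring := hA'O.trans hO
  haveI : IsFractionRing A.toSubring K := hfrac
  haveI hfrac' : IsFractionRing A'.toSubring K := isFractionRing_subalgebra_of_le A A' hAA'
  -- tracking: `A' ⊆ A_p` (the new generators are fractions with denominators outside `p`)
  have h1 : (A' : Set K) ⊆ (Localization.subalgebra.ofField K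
      ((maximalIdeal O₁).comap (Subring.inclusion hAO₁)).primeCompl
      (Ideal.primeCompl_le_nonZeroDivisors _)) := by
    refine fun x hx => (sup_le (fun x hx => le_centreLocalization O₁ A hAO₁ hx)
      (Algebra.adjoin_le ?_) : A' ≤ { ((Localization.subalgebra.ofField K
          ((maximalIdeal O₁).comap (Subring.inclusion hAO₁)).primeCompl
          (Ideal.primeCompl_le_nonZeroDivisors _))).toSubring with
        algebraMap_mem' := fun c =>
          le_centreLocalization O₁ A hAO₁ (A.algebraMap_mem c) }) hx
    intro x hx
    rw [Finset.coe_image] at hx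
    obtain ⟨b, -, rfl⟩ := hx
    change g b ∈ (Localization.subalgebra.ofField K
        ((maximalIdeal O₁).comap (Subring.inclusion hAO₁)).primeCompl
        (Ideal.primeCompl_le_nonZeroDivisors _))
    rw [mem_centreLocalization_iff]
    exact ⟨fa b, (fa b).2, fs b, (fs b).2, hφunit _ (hfs b), div_eq_mul_inv _ _⟩
  refine ⟨A', hA'O, hAA', hA'fg, ?_, ?_,
    fun x hx => (mem_centreLocalization_iff O₁ A hAO₁ x).mp (h1 hx)⟩
  · -- Claim 1: the local ring at the centre of `ν₁` is unchanged (Lemma 2.15, second part).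
    have h2 : (A : Set K) ⊆ (Localization.subalgebra.ofField K
        ((maximalIdeal O₁).comap (Subring.inclusion hA'O₁)).primeCompl
        (Ideal.primeCompl_le_nonZeroDivisors _)) :=
      fun x hx => le_centreLocalization O₁ A' hA'O₁ (hAA' hx)
    have heq : ((Localization.subalgebra.ofField K
        ((maximalIdeal O₁).comap (Subring.inclusion hA'O₁)).primeCompl
        (Ideal.primeCompl_le_nonZeroDivisors _)) : Set K)
        = (Localization.subalgebra.ofField K
        ((maximalIdeal O₁).comap (Subring.inclusion hAO₁)).primeCompl
        (Ideal.primeCompl_le_nonZeroDivisors _)) :=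
      le_antisymm (centreLocalization_le O₁ A' A hA'O₁ hAO₁ h1)
        (centreLocalization_le O₁ A A' hAO₁ hA'O₁ h2)
    exact isRegularLocalRing_of_centreLocalization_eq O₁ A' A hA'O₁ hAO₁ heq hregP
  · -- Claim 2: `A'_{Q'} / P' A'_{Q'}` is the local ring of `B` at the centre of `ν₂`
    -- (Lemma 2.15, first part), realised inside `κ(O₁)`.
    set Q' := ((maximalIdeal O).comap (Subring.inclusion hA'O)) with hQ'def
    set P' := ((maximalIdeal O₁).comap (Subring.inclusion hA'O₁)) with hP'def
    have hP'Q' : P' ≤ Q' := centre_mono O O₁ hO A' hA'O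
    let S := Localization.AtPrime Q'
    let ψ : A'.toSubring →+* ResidueField O₁ := ((residue O₁).comp (Subring.inclusion hA'O₁))
    -- `ψ(A') ⊆ ι(B)`
    have hψB : ∀ x : A'.toSubring, ∃ b : κ, b ∈ B ∧ ψ x = b := by
      let T : Subalgebra k K :=
        { (((B.toSubring.map ι).comap (residue O₁)).map O₁.toSubring.subtype) with
          algebraMap_mem' := fun c => by
            change algebraMap k K c ∈ (((B.toSubring.map ι).comap (residue O₁)).map
                O₁.toSubring.subtype)
            rw [mem_map_subtype_comap_residue_iff]
            refine ⟨hAO₁ (A.algebraMap_mem c), ?_⟩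
            rw [Subring.mem_map]
            refine ⟨φκ ⟨algebraMap k K c, A.algebraMap_mem c⟩, hB₀B ((hmemB₀ _).mpr ⟨_, rfl⟩),
              rfl⟩ }
      have hA'T : A' ≤ T := by
        refine sup_le (fun x hx => ?_) (Algebra.adjoin_le fun x hx => ?_)
        · change x ∈ (((B.toSubring.map ι).comap (residue O₁)).map O₁.toSubring.subtype)
          rw [mem_map_subtype_comap_residue_iff]
          refine ⟨hAO₁ hx, ?_⟩
          rw [Subring.mem_map]
          exact ⟨φκ ⟨x, hx⟩, hB₀B ((hmemB₀ _).mpr ⟨_, rfl⟩), rfl⟩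
        · rw [Finset.coe_image] at hx
          obtain ⟨b, hb, rfl⟩ := hx
          change g b ∈ (((B.toSubring.map ι).comap (residue O₁)).map O₁.toSubring.subtype)
          rw [mem_map_subtype_comap_residue_iff]
          refine ⟨hgO₁ b, ?_⟩
          rw [Subring.mem_map, hgres b]
          exact ⟨b, htBB b hb, rfl⟩
      intro x
      have hx := hA'T x.2
      change (x : K) ∈ (((B.toSubring.map ι).comap (residue O₁)).map O₁.toSubring.subtype) at hx
      rw [mem_map_subtype_comap_residue_iff] at hx
      obtain ⟨hx₁, hx₂⟩ := hx
      rw [Subring.mem_map] at hx₂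
      obtain ⟨b, hb, hb'⟩ := hx₂
      exact ⟨b, hb, hb'.symm⟩
    -- units: `s ∉ Q'` iff `ψ s` is a unit of `O₂`
    have hψO₂ : ∀ x : A'.toSubring, ψ x ∈ O₂ := fun x =>
      (residue_mem_residueValuationSubring_iff O O₁ hO _).mpr (hA'O x.2)
    have hQ'iff : ∀ s : A'.toSubring, s ∉ Q' ↔ IsUnit (⟨ψ s, hψO₂ s⟩ : O₂) := by
      intro s
      rw [mem_centre_iff_lt_one, valuation_lt_one_iff_residue O O₁ hO (s : K) (hA'O s.2)]
      exact not_valuation_lt_one_iff O₂ ⟨ψ s, hψO₂ s⟩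
    have hunits : ∀ s : Q'.primeCompl, IsUnit (ψ s) := fun s =>
      isUnit_residue_inclusion O₁ A' hA'O₁ s (fun h => s.2 (hP'Q' h))
    let θ : S →+* ResidueField O₁ := IsLocalization.lift hunits
    have hθmk : ∀ (a : A'.toSubring) (s : Q'.primeCompl),
        θ (IsLocalization.mk' S a s) = ψ a / ψ s := by
      intro a s
      rw [IsLocalization.lift_mk'_spec]
      field_simp [(hunits s).ne_zero]
    -- the kernel of `θ`
    have hker : RingHom.ker θ = P'.map (algebraMap A'.toSubring S) := by
      apply le_antisymm
      · intro x hx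
        rw [← IsLocalization.mk'_sec (M := Q'.primeCompl) S x] at hx ⊢
        set a := (IsLocalization.sec Q'.primeCompl x).1
        set s := (IsLocalization.sec Q'.primeCompl x).2
        rw [RingHom.mem_ker, hθmk, div_eq_zero_iff, or_iff_left (hunits s).ne_zero] at hx
        have ha : a ∈ P' := (residue_inclusion_eq_zero_iff O₁ A' hA'O₁ a).mp hx
        rw [IsLocalization.mk'_eq_mul_mk'_one]
        exact Ideal.mul_mem_right _ _ (Ideal.mem_map_of_mem _ ha)
      · rw [Ideal.map_le_iff_le_comap]
        intro a ha
        rw [Ideal.mem_comap, RingHom.mem_ker, IsLocalization.lift_eq]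
        exact (residue_inclusion_eq_zero_iff O₁ A' hA'O₁ a).mpr ha
    -- `ψ` maps `A'` onto `B`
    let ψκ : A' →ₐ[k] κ :=
      { toFun := fun x => ⟨ψ x, by obtain ⟨b, -, hb⟩ := hψB x; rw [hb]; exact b.2⟩
        map_one' := Subtype.ext (map_one ψ)
        map_mul' := fun x y => Subtype.ext (map_mul ψ x y)
        map_zero' := Subtype.ext (map_zero ψ)
        map_add' := fun x y => Subtype.ext (map_add ψ x y)
        commutes' := fun c => Subtype.ext rfl }
    have hBψ : ∀ b : κ, b ∈ B → ∃ x : A'.toSubring, ψ x = b := by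
      have hle : B ≤ ψκ.range := by
        rw [← htB]
        refine Algebra.adjoin_le fun b hb => ?_
        have hgb : g b ∈ A' := by
          apply (le_sup_right : Algebra.adjoin k _ ≤ A')
          apply Algebra.subset_adjoin
          rw [Finset.coe_image]; exact ⟨b, hb, rfl⟩
        refine ⟨⟨g b, hgb⟩, Subtype.ext ?_⟩
        exact hgres b
      intro b hb
      obtain ⟨x, hx⟩ := hle hb
      exact ⟨x, congrArg Subtype.val hx⟩
    -- the range of `θ` is `ι` of the local ring of `B` at the centre of `ν₂`
    haveI : IsFractionRing B₀.toSubring κ := hB₀frac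
    haveI hBfrac : IsFractionRing B.toSubring κ := isFractionRing_subalgebra_of_le B₀ B hB₀B
    have hBO₂' : ∀ b : κ, b ∈ B → b ∈ O₂' := fun b hb => hB hb
    have hunitB : ∀ (b : κ) (hb : b ∈ B), O₂'.valuation b = 1 ↔
        IsUnit (⟨ι b, hBO₂' b hb⟩ : O₂) := by
      intro b hb
      rw [← isUnit_comap_iff O₂ ι b (hBO₂' b hb), ValuationSubring.valuation_eq_one_iff]
    have hrangeθ : θ.range = ((Localization.subalgebra.ofField κ
        ((maximalIdeal O₂').comap (Subring.inclusion hB)).primeCompl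
        (Ideal.primeCompl_le_nonZeroDivisors _))).toSubring.map ι := by
      ext y
      constructor
      · rintro ⟨x, rfl⟩
        rw [← IsLocalization.mk'_sec (M := Q'.primeCompl) S x]
        set a := (IsLocalization.sec Q'.primeCompl x).1
        set s := (IsLocalization.sec Q'.primeCompl x).2
        obtain ⟨ba, hba, hψa⟩ := hψB a
        obtain ⟨bs, hbs, hψs⟩ := hψB s
        rw [hθmk, Subring.mem_map]
        refine ⟨ba * bs⁻¹, ?_, ?_⟩
        · change ba * bs⁻¹ ∈ (Localization.subalgebra.ofField κ
            ((maximalIdeal O₂').comap (Subring.inclusion hB)).primeCompl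
            (Ideal.primeCompl_le_nonZeroDivisors _))
          rw [mem_centreLocalization_iff]
          refine ⟨ba, hba, bs, hbs, ?_, rfl⟩
          rw [hunitB bs hbs]
          have e : (⟨ι bs, hBO₂' bs hbs⟩ : O₂) = ⟨ψ s, hψO₂ s⟩ := Subtype.ext hψs.symm
          rw [e]
          exact (hQ'iff s).mp s.2
        · change ((ba * bs⁻¹ : κ) : ResidueField O₁) = ψ a / ψ s
          push_cast
          rw [hψa, hψs, div_eq_mul_inv]
      · intro hy
        rw [Subring.mem_map] at hy
        obtain ⟨x, hx, rfl⟩ := hy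
        change x ∈ (Localization.subalgebra.ofField κ
            ((maximalIdeal O₂').comap (Subring.inclusion hB)).primeCompl
            (Ideal.primeCompl_le_nonZeroDivisors _)) at hx
        rw [mem_centreLocalization_iff] at hx
        obtain ⟨b₁, hb₁, u, hu, hu1, rfl⟩ := hx
        obtain ⟨a₁, ha₁⟩ := hBψ b₁ hb₁
        obtain ⟨s₁, hs₁⟩ := hBψ u hu
        have hs₁Q : s₁ ∉ Q' := by
          rw [hQ'iff s₁]
          have e : (⟨ψ s₁, hψO₂ s₁⟩ : O₂) = ⟨ι u, hBO₂' u hu⟩ := Subtype.ext hs₁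
          rw [e]
          exact (hunitB u hu).mp hu1
        refine ⟨IsLocalization.mk' S a₁ (⟨s₁, hs₁Q⟩ : Q'.primeCompl), ?_⟩
        rw [hθmk]
        change ψ a₁ / ψ s₁ = ι (b₁ * u⁻¹)
        rw [map_mul, map_inv₀, ha₁, hs₁, div_eq_mul_inv]
        rfl
    -- assemble the isomorphism `S / P' S ≅ B_{m_{ν₂} ∩ B}` and transfer regularity
    set X : Subalgebra B.toSubring κ := Localization.subalgebra.ofField κ
        ((maximalIdeal O₂').comap (Subring.inclusion hB)).primeCompl
        (Ideal.primeCompl_le_nonZeroDivisors _) with hXdef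
    have hregL : IsRegularLocalRing X :=
      (isRegularLocalRing_iff_centreLocalization O₂' B hB).mp hregB
    let e₁ : S ⧸ P'.map (algebraMap A'.toSubring S) ≃+* θ.range :=
      (Ideal.quotEquivOfEq hker.symm).trans (RingHom.quotientKerEquivRange θ)
    let e₂ : θ.range ≃+* X.toSubring.map ι := RingEquiv.subringCongr hrangeθ
    let e₃ : X.toSubring ≃+* X.toSubring.map ι :=
      Subring.equivMapOfInjective X.toSubring ι ι.injective
    haveI := hregL
    exact IsRegularLocalRing.of_ringEquiv (R := X) (e₃.trans (e₂.symm.trans e₁.symm))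

end tracked

end Literature.AlgebraicGeometry.Resolution

end
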